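import Summits.ResolutionOfSingularities.ResolutionOfSingularities.Theorems.WeightedInvariantIota3SecondRoot
import Mathlib.Algebra.Polynomial.Taylor
import Mathlib.Algebra.Polynomial.HasseDeriv
import HarnessLib

/-!
# LEMMA C′ in iterated-polynomial form, I: the VANISHING LEMMA (`Y ∣ P` forces `τ = 0`) and the case `τ = 0`
# (door `HypersurfaceCentreConstruction`, stmt-ResolutionOfSingularities-19897; proof of LEMMA C′, memo RESIDUE-PLAN.md §3b)

Helper for `stub_keyRungGrHomLE_three` (def-free, `--supports 19897`).  LEMMA C′ (hypothesis `hC'` of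
`keyRungGrHomLE_three_of_lemmaC'`) is proved in the ring `κ[X][V][Y] = Polynomial (Polynomial (Polynomial κ))`
(`X` = `X₀` the parameter, `V` = `X₁`, `Y` = `X₂`): a PURE polynomial is `P = Σ_c λ_c V^{e_c} Y^c` with
`r₂ e_c = r₁ (ν − c)` whenever `λ_c ≠ 0`, and the FUNCTIONAL EQUATION is `P = taylor τ (P.map (taylor T))`,
`T = ε X^j` (`P(V, Y) = P(V + T, Y + τ)`, `τ ∈ κ[X][V]`).  This file: `natDegree_le`, `eval_map_taylor` (the value
`Σ_c λ_c (V+T)^{e_c} τ^c` of the right-hand side at `Y = 0`), **`lam_eq_zero_of_tau_eq_zero`** (if `τ = 0` then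
`λ_c = 0` for `c < ν`: the `V^0`-coefficient of `λ_c (V+T)^{e_c}` is `λ_c T^{e_c} ≠ 0`), and the VANISHING LEMMA
**`tau_eq_zero_of_lam_zero`**: if `λ_0 = 0` (`Y ∣ P`) and either `r₂ ∤ r₁` or `τ(X, 0) = 0`, then `τ = 0`
(put `Y = 0`, factor `τ^{m₀}`, undo `V ↦ V + T`; the `V`-degrees `e_c + (c − m₀)·deg τ` of the terms are
pairwise distinct unless `r₂ · deg τ = r₁` — no cancellation; if `r₂ ∣ r₁` the second-root lemma gives
`τ = g (V + T)^{r₁/r₂}` with `g ∈ κ^×`, contradicting `τ(X, 0) = 0`).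
[OURS · L1 W4.3 · (o70-b)/(Δ12); AI work, weaker than expert review; nothing here is a statement of the manuscript under review.]
-/

noncomputable section

open Polynomial

set_option linter.dupNamespace false -- mandated namespace of this single-conjunct summit

namespace Summit.ResolutionOfSingularities.ResolutionOfSingularities.Cruxes.HypersurfaceCentreConstruction.LocalEngine

namespace Iota3

namespace LemmaCPrime

variable {κ : Type} [Field κ]

/-- The translation parameter `T = ε X^j` is non-zero. [folklore] -/
theorem T_ne_zero {ε : κ} (hε : ε ≠ 0) (j : ℕ) : (C ε * X ^ j : κ[X]) ≠ 0 :=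
  mul_ne_zero (by rwa [Ne, C_eq_zero]) (pow_ne_zero _ X_ne_zero)

/-- A pure polynomial `P = Σ_c λ_c V^{e_c} Y^c` (with `λ_c = 0` for `c > ν`) has `Y`-degree `≤ ν`. [folklore] -/
theorem natDegree_le {r₁ r₂ ν : ℕ} {lam : ℕ → κ} {ex : ℕ → ℕ} {P : κ[X][X][X]}
    (hP : ∀ c, P.coeff c = monomial (ex c) (C (lam c))) (hex : ∀ c, lam c ≠ 0 → c ≤ ν ∧ r₂ * ex c = r₁ * (ν - c)) :
    P.natDegree ≤ ν := by
  rw [natDegree_le_iff_coeff_eq_zero]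
  intro c hc
  have hl : lam c = 0 := by
    by_contra h
    have := (hex c h).1
    exact absurd hc (not_lt.mpr (by exact_mod_cast this))
  rw [hP c, hl, map_zero, map_zero]

/-- The coefficients of `P.map (taylor T)`: `λ_c (V + T)^{e_c}`. [folklore] -/
theorem coeff_map_taylor {lam : ℕ → κ} {ex : ℕ → ℕ} {P : κ[X][X][X]}
    (hP : ∀ c, P.coeff c = monomial (ex c) (C (lam c))) (T : κ[X]) (c : ℕ) :
    (P.map (taylorAlgHom T).toRingHom).coeff c = C (C (lam c)) * (X + C T) ^ (ex c) := by
  rw [coeff_map, hP c, AlgHom.toRingHom_eq_coe, AlgHom.coe_toRingHom, taylorAlgHom_apply, taylor_monomial]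

/-- **The right-hand side of the functional equation at `Y = 0`**: `(P.map (taylor T)).eval τ = Σ_{c ≤ ν} λ_c (V+T)^{e_c} τ^c`.
[folklore] -/
theorem eval_map_taylor {r₁ r₂ ν : ℕ} {lam : ℕ → κ} {ex : ℕ → ℕ} {P : κ[X][X][X]}
    (hP : ∀ c, P.coeff c = monomial (ex c) (C (lam c))) (hex : ∀ c, lam c ≠ 0 → c ≤ ν ∧ r₂ * ex c = r₁ * (ν - c))
    (T : κ[X]) (τ : κ[X][X]) :
    (P.map (taylorAlgHom T).toRingHom).eval τ =
      ∑ c ∈ Finset.range (ν + 1), C (C (lam c)) * (X + C T) ^ (ex c) * τ ^ c := by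
  have hdeg : (P.map (taylorAlgHom T).toRingHom).natDegree < ν + 1 :=
    lt_of_le_of_lt ((natDegree_map_le).trans (natDegree_le hP hex)) (Nat.lt_succ_self ν)
  rw [eval_eq_sum_range' hdeg]
  exact Finset.sum_congr rfl fun c _ => by rw [coeff_map_taylor hP]

/-- **The functional equation at `Y = 0`**: `λ_0 V^{e_0} = Σ_{c ≤ ν} λ_c (V+T)^{e_c} τ^c`. [folklore] -/
theorem fe_eval_zero {r₁ r₂ ν : ℕ} {lam : ℕ → κ} {ex : ℕ → ℕ} {P : κ[X][X][X]}
    (hP : ∀ c, P.coeff c = monomial (ex c) (C (lam c))) (hex : ∀ c, lam c ≠ 0 → c ≤ ν ∧ r₂ * ex c = r₁ * (ν - c))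
    {T : κ[X]} {τ : κ[X][X]} (hfe : P = taylor τ (P.map (taylorAlgHom T).toRingHom)) :
    monomial (ex 0) (C (lam 0)) = ∑ c ∈ Finset.range (ν + 1), C (C (lam c)) * (X + C T) ^ (ex c) * τ ^ c := by
  rw [← eval_map_taylor hP hex T τ, ← hP 0, coeff_zero_eq_eval_zero]
  conv_lhs => rw [hfe]
  rw [taylor_eval, zero_add]

/-- **If `τ = 0` then `λ_c = 0` for all `c < ν`** (`P(V, Y) = P(V + T, Y)` with `T ≠ 0`: the `V^0`-coefficient of
`λ_c (V + T)^{e_c}` is `λ_c T^{e_c}`, and `e_c ≥ 1` for `c < ν`). [OURS · L1 W4.3 · (o70-b)/(Δ12)] -/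
theorem lam_eq_zero_of_tau_eq_zero {r₁ r₂ ν : ℕ} (hr : r₂ < r₁) {lam : ℕ → κ} {ex : ℕ → ℕ} {P : κ[X][X][X]}
    (hP : ∀ c, P.coeff c = monomial (ex c) (C (lam c))) (hex : ∀ c, lam c ≠ 0 → c ≤ ν ∧ r₂ * ex c = r₁ * (ν - c))
    {ε : κ} (hε : ε ≠ 0) {j : ℕ} (hfe : P = taylor 0 (P.map (taylorAlgHom (C ε * X ^ j)).toRingHom)) :
    ∀ c, c < ν → lam c = 0 := by
  intro c hc
  by_contra hl
  have hexc : ex c ≠ 0 := by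
    intro h0
    have h1 := (hex c hl).2
    rw [h0, mul_zero] at h1
    have : 0 < r₁ * (ν - c) := Nat.mul_pos (by omega) (by omega)
    omega
  have h := congr_arg (fun Q => (Q.coeff c).coeff 0) hfe
  simp only [taylor_zero] at h
  rw [coeff_map_taylor hP, hP c, coeff_monomial, if_neg hexc, coeff_zero_eq_eval_zero, eval_mul, eval_C,
    eval_pow, eval_add, eval_X, eval_C, zero_add] at h
  exact (mul_ne_zero (by rwa [Ne, C_eq_zero]) (pow_ne_zero _ (T_ne_zero hε j))) h.symm

/-- `taylor (−T)` undoes `V ↦ V + T` on the binomial powers: `taylor (−T) ((V + T)^e) = V^e`. [folklore] -/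
theorem taylor_neg_X_add_C_pow (T : κ[X]) (e : ℕ) : taylor (-T) ((X + C T) ^ e : κ[X][X]) = X ^ e := by
  rw [taylor_pow, map_add, taylor_X, taylor_C, map_neg, add_assoc, neg_add_cancel, add_zero]

/-- **THE VANISHING LEMMA.**  For a pure `P = Σ_c λ_c V^{e_c} Y^c` (`r₂ e_c = r₁(ν − c)` when `λ_c ≠ 0`, `λ_ν ≠ 0`,
so `1 ≤ ν`) with `λ_0 = 0` satisfying the functional equation `P(V, Y) = P(V + εX^j, Y + τ)` (`ε ≠ 0`): if `r₂ ∤ r₁`, or if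
`τ(X, 0) = 0`, then `τ = 0`. [OURS · L1 W4.3 · (o70-b)/(Δ12)] -/
theorem tau_eq_zero_of_lam_zero {r₁ r₂ ν : ℕ} (hr₂ : 0 < r₂) {lam : ℕ → κ} {ex : ℕ → ℕ}
    {P : κ[X][X][X]} (hP : ∀ c, P.coeff c = monomial (ex c) (C (lam c)))
    (hex : ∀ c, lam c ≠ 0 → c ≤ ν ∧ r₂ * ex c = r₁ * (ν - c)) (hν : lam ν ≠ 0) (hlam0 : lam 0 = 0)
    {ε : κ} (hε : ε ≠ 0) {j : ℕ} {τ : κ[X][X]} (hfe : P = taylor τ (P.map (taylorAlgHom (C ε * X ^ j)).toRingHom))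
    (hτ : ¬ r₂ ∣ r₁ ∨ τ.coeff 0 = 0) : τ = 0 := by
  classical
  set T : κ[X] := C ε * X ^ j with hT
  have hT0 : T ≠ 0 := T_ne_zero hε j
  have hXT : (X + C T : κ[X][X]) ≠ 0 := X_add_C_ne_zero T
  by_contra hτ0
  -- the functional equation at `Y = 0`
  have E1 : ∑ c ∈ Finset.range (ν + 1), C (C (lam c)) * (X + C T) ^ (ex c) * τ ^ c = 0 := by
    rw [← fe_eval_zero hP hex hfe, hlam0, map_zero, map_zero]
  -- the smallest index with `λ ≠ 0`
  have hex' : ∃ c, lam c ≠ 0 := ⟨ν, hν⟩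
  set m₀ := Nat.find hex' with hm₀def
  have hm₀ : lam m₀ ≠ 0 := Nat.find_spec hex'
  have hm₀ν : m₀ ≤ ν := Nat.find_min' hex' hν
  have hmin : ∀ c, c < m₀ → lam c = 0 := fun c hc => by
    by_contra h; exact absurd (Nat.find_min' hex' h) (not_le.mpr hc)
  have hm₀1 : 1 ≤ m₀ := by
    rcases Nat.eq_zero_or_pos m₀ with h | h
    · exact absurd (h ▸ hlam0 : lam m₀ = 0) hm₀
    · exact h
  set n := ν - m₀ with hn
  -- split off the vanishing terms `c < m₀` and factor `τ^{m₀}`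
  have E2 : ∑ k ∈ Finset.range (n + 1), C (C (lam (m₀ + k))) * (X + C T) ^ (ex (m₀ + k)) * τ ^ k = 0 := by
    have hsplit := (Finset.sum_range_add_sum_Ico (fun c => C (C (lam c)) * (X + C T) ^ (ex c) * τ ^ c)
      (show m₀ ≤ ν + 1 by omega)).symm
    rw [E1] at hsplit
    rw [Finset.sum_eq_zero (fun c hc => by rw [hmin c (Finset.mem_range.mp hc), map_zero, map_zero, zero_mul, zero_mul]),
      zero_add, Finset.sum_Ico_eq_sum_range, show ν + 1 - m₀ = n + 1 by omega] at hsplit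
    have hfac : ∑ k ∈ Finset.range (n + 1), C (C (lam (m₀ + k))) * (X + C T) ^ (ex (m₀ + k)) * τ ^ (m₀ + k) =
        τ ^ m₀ * ∑ k ∈ Finset.range (n + 1), C (C (lam (m₀ + k))) * (X + C T) ^ (ex (m₀ + k)) * τ ^ k := by
      rw [Finset.mul_sum]
      exact Finset.sum_congr rfl fun k _ => by rw [pow_add]; ring
    rw [hfac] at hsplit
    exact (mul_eq_zero.mp hsplit.symm).resolve_left (pow_ne_zero _ hτ0)
  -- undo `V ↦ V + T`
  set τ'' : κ[X][X] := taylor (-T) τ with hτ''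
  have hτ''0 : τ'' ≠ 0 := by rwa [hτ'', Ne, taylor_eq_zero]
  have hττ'' : τ = taylor T τ'' := by rw [hτ'', taylor_taylor, add_neg_cancel, taylor_zero]
  have E3 : ∑ k ∈ Finset.range (n + 1), C (C (lam (m₀ + k))) * X ^ (ex (m₀ + k)) * τ'' ^ k = 0 := by
    have h := congr_arg (taylor (-T)) E2
    rw [map_sum, map_zero] at h
    rw [← h]
    refine Finset.sum_congr rfl fun k _ => ?_
    rw [taylor_mul, taylor_mul, taylor_C, taylor_neg_X_add_C_pow, taylor_pow]
  have hnmem : n ∈ Finset.range (n + 1) := Finset.mem_range.mpr (Nat.lt_succ_self n)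
  have hm₀n : m₀ + n = ν := by omega
  -- the non-zero terms and their degrees
  have hterm_ne : ∀ k, lam (m₀ + k) ≠ 0 → C (C (lam (m₀ + k))) * (X : κ[X][X]) ^ (ex (m₀ + k)) * τ'' ^ k ≠ 0 :=
    fun k hl => mul_ne_zero (mul_ne_zero (by rw [Ne, C_eq_zero, C_eq_zero]; exact hl) (pow_ne_zero _ X_ne_zero))
      (pow_ne_zero _ hτ''0)
  have hlam_of_ne : ∀ k, C (C (lam (m₀ + k))) * (X : κ[X][X]) ^ (ex (m₀ + k)) * τ'' ^ k ≠ 0 → lam (m₀ + k) ≠ 0 := by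
    intro k h hl; rw [hl, map_zero, map_zero, zero_mul, zero_mul] at h; exact h rfl
  have hdeg : ∀ k, lam (m₀ + k) ≠ 0 →
      (C (C (lam (m₀ + k))) * (X : κ[X][X]) ^ (ex (m₀ + k)) * τ'' ^ k).natDegree = ex (m₀ + k) + k * τ''.natDegree := by
    intro k hl
    rw [natDegree_mul (mul_ne_zero (by rw [Ne, C_eq_zero, C_eq_zero]; exact hl) (pow_ne_zero _ X_ne_zero)) (pow_ne_zero _ hτ''0),
      natDegree_C_mul_X_pow _ _ (by rw [Ne, C_eq_zero]; exact hl), natDegree_pow]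
  -- `r₂ ∣ r₁`: otherwise the degrees are pairwise distinct, no cancellation, but the `k = n` term is non-zero
  have hdvd : r₂ ∣ r₁ := by
    by_contra hndvd
    have hdist : ∀ k ∈ Finset.range (n + 1), ∀ k' ∈ Finset.range (n + 1), k ≠ k' →
        C (C (lam (m₀ + k))) * (X : κ[X][X]) ^ (ex (m₀ + k)) * τ'' ^ k ≠ 0 →
        C (C (lam (m₀ + k'))) * (X : κ[X][X]) ^ (ex (m₀ + k')) * τ'' ^ k' ≠ 0 →
        (C (C (lam (m₀ + k))) * (X : κ[X][X]) ^ (ex (m₀ + k)) * τ'' ^ k).natDegree ≠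
          (C (C (lam (m₀ + k'))) * (X : κ[X][X]) ^ (ex (m₀ + k')) * τ'' ^ k').natDegree := by
      intro k hk k' hk' hkk' hf hf' heq
      have hl := hlam_of_ne k hf
      have hl' := hlam_of_ne k' hf'
      rw [hdeg k hl, hdeg k' hl'] at heq
      obtain ⟨hkν, hexk⟩ := hex _ hl
      obtain ⟨hk'ν, hexk'⟩ := hex _ hl'
      -- `r₂ (e_k + k d) = r₁(ν − m₀ − k) + r₂ k d`
      have h1 : ((k : ℤ) - k') * ((r₂ : ℤ) * τ''.natDegree - r₁) = 0 := by
        have heqZ : ((r₂ * (ex (m₀ + k) + k * τ''.natDegree) : ℕ) : ℤ) = ((r₂ * (ex (m₀ + k') + k' * τ''.natDegree) : ℕ) : ℤ) := by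
          rw [heq]
        have e1 : ((r₂ * ex (m₀ + k) : ℕ) : ℤ) = (r₁ : ℤ) * ((ν : ℤ) - m₀ - k) := by
          rw [hexk]; push_cast [Nat.cast_sub hkν]; ring
        have e2 : ((r₂ * ex (m₀ + k') : ℕ) : ℤ) = (r₁ : ℤ) * ((ν : ℤ) - m₀ - k') := by
          rw [hexk']; push_cast [Nat.cast_sub hk'ν]; ring
        push_cast at heqZ e1 e2
        rw [mul_add, mul_add, e1, e2] at heqZ
        linear_combination heqZ
      rcases mul_eq_zero.mp h1 with h2 | h2
      · exact hkk' (by exact_mod_cast sub_eq_zero.mp h2)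
      · exact hndvd ⟨τ''.natDegree, by exact_mod_cast (sub_eq_zero.mp h2).symm⟩
    have hall := PolynomialD.eq_zero_of_natDegree_injOn _ _ hdist E3
    exact hterm_ne n (by rw [hm₀n]; exact hν) (hall n hnmem)
  rcases hτ with hndvd | hcoeff
  · exact hndvd hdvd
  · -- Case `r₂ ∣ r₁` and `τ(X, 0) = 0`: the second-root lemma
    obtain ⟨ρ, hρ⟩ := hdvd
    have hexρ : ∀ k, lam (m₀ + k) ≠ 0 → ex (m₀ + k) = ρ * (n - k) := by
      intro k hl
      obtain ⟨hkν, hexk⟩ := hex _ hl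
      rw [hρ, mul_assoc] at hexk
      have := Nat.eq_of_mul_eq_mul_left hr₂ hexk
      rw [this]; congr 1; omega
    have E4 : ∑ k ∈ Finset.range (n + 1), C (C (lam (m₀ + k))) * (X : κ[X][X]) ^ (ρ * (n - k)) * τ'' ^ k = 0 := by
      rw [← E3]
      refine Finset.sum_congr rfl fun k _ => ?_
      by_cases hl : lam (m₀ + k) = 0
      · rw [hl, map_zero, map_zero, zero_mul, zero_mul, zero_mul, zero_mul]
      · rw [hexρ k hl]
    obtain ⟨g, hg0, hτ''eq, hroot⟩ := PolynomialD.eq_C_mul_X_pow_of_rootRelation n ρ (fun k => C (lam (m₀ + k)))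
      (by rw [Ne, add_zero, C_eq_zero]; exact hm₀) (by rw [Ne, hm₀n, C_eq_zero]; exact hν) τ'' hτ''0 E4
    -- `g` is a constant: no cancellation among the `X`-degrees `k · deg g`
    have hgdeg : g.natDegree = 0 := by
      by_contra hgd
      have hgd' : 0 < g.natDegree := Nat.pos_of_ne_zero hgd
      have hdist : ∀ k ∈ Finset.range (n + 1), ∀ k' ∈ Finset.range (n + 1), k ≠ k' →
          C (lam (m₀ + k)) * g ^ k ≠ 0 → C (lam (m₀ + k')) * g ^ k' ≠ 0 →
          (C (lam (m₀ + k)) * g ^ k).natDegree ≠ (C (lam (m₀ + k')) * g ^ k').natDegree := by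
        intro k _ k' _ hkk' hf hf' heq
        have hl : lam (m₀ + k) ≠ 0 := by rintro h; rw [h, map_zero, zero_mul] at hf; exact hf rfl
        have hl' : lam (m₀ + k') ≠ 0 := by rintro h; rw [h, map_zero, zero_mul] at hf'; exact hf' rfl
        rw [natDegree_C_mul hl, natDegree_C_mul hl', natDegree_pow, natDegree_pow] at heq
        exact hkk' (Nat.eq_of_mul_eq_mul_right hgd' heq)
      have hall := PolynomialD.eq_zero_of_natDegree_injOn _ _ hdist hroot
      have hn0 := hall n hnmem
      rw [hm₀n] at hn0
      exact (mul_ne_zero (by rwa [Ne, C_eq_zero]) (pow_ne_zero _ hg0)) hn0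
    obtain ⟨g₀, hg₀⟩ : ∃ g₀ : κ, g = C g₀ := ⟨g.coeff 0, eq_C_of_natDegree_eq_zero hgdeg⟩
    have hg₀0 : g₀ ≠ 0 := by rintro rfl; rw [map_zero] at hg₀; exact hg0 hg₀
    -- `τ = g₀ (V + T)^ρ` has `τ(X, 0) = g₀ T^ρ ≠ 0`
    have hτeq : τ = C (C g₀) * (X + C T) ^ ρ := by
      rw [hττ'', hτ''eq, hg₀, taylor_mul, taylor_C, taylor_pow, taylor_X]
    rw [hτeq, coeff_zero_eq_eval_zero, eval_mul, eval_C, eval_pow, eval_add, eval_X, eval_C, zero_add] at hcoeff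
    exact (mul_ne_zero (by rwa [Ne, C_eq_zero]) (pow_ne_zero _ hT0)) hcoeff

end LemmaCPrime

end Iota3

end Summit.ResolutionOfSingularities.ResolutionOfSingularities.Cruxes.HypersurfaceCentreConstruction.LocalEngine

end
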